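import Literature.Analysis.Complex.OmittedRootsOfUnityMeanGrowth
import Literature.Analysis.Complex.PlaneDomainDiscCoveringLift
import Literature.Analysis.Complex.PlaneDomainExtremalCovering
import Literature.NumberTheory.Automorphic.ModularLambdaNome
import HarnessLib

/-!
# The universal covering `F_N : 𝔻 → ℂ ∖ μ_N` and CDT Theorem 6.0.1 for it

`Literature/Analysis/Complex/RootsOfUnityComplementUniformization.lean` — PROOF-ONLY (no definition,
no named fact).

F. Calegari, V. Dimitrov, Y. Tang, *The unbounded denominators conjecture*, J. Amer. Math. Soc. 38
(2025), §5 (arXiv:2109.09040 §5, Definition 32 and Lemma 33): for `N ≥ 2` the domain `ℂ ∖ μ_N` is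
hyperbolic and has a holomorphic universal covering `F_N : D(0,1) → ℂ ∖ μ_N` with `F_N(0) = 0`,
unique up to a rotation of the disc. Here, from the tree's uniformization of plane domains
(`Complex.planeDomainDiscCovering_holds`, Fisher–Hubbard–Wittner) and disc-covering toolkit
(`PlaneDomainDiscCoveringLift.lean`, `PlaneDomainExtremalCovering.lean`):

* `exists_isCoveringMap_compl_rootsOfUnity` — EXISTENCE: for `N ≥ 2` there is `F` holomorphic on the
  unit disc, mapping it ONTO `{z | zᴺ ≠ 1}` as a covering map, with `F 0 = 0`;
* `one_le_norm_deriv_zero_of_isCoveringMap_compl_rootsOfUnity` — every such covering has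
  `‖F′(0)‖ ≥ 1` (the inclusion `𝔻 ⊂ ℂ ∖ μ_N` is subordinate to `F`; CDT use the much finer
  `‖F_N′(0)‖ = 16^{1/N}(1 + ζ(3)/(2N³) + …)`, their Theorem 5.1.4, NOT proved here) and `F′ ≠ 0`;
* `rpow_le_norm_deriv_zero_of_isCoveringMap_compl_rootsOfUnity` (appended) — `‖F′(0)‖ ≥ 16^{1/N}`,
  the subordination half of the conformal radius (competitor `16^{1/N}(λ(zᴺ)/16)^{1/N}` from
  `ModularLambdaNome.lean`);
* `apply_mul_eq_mul_apply_of_isCoveringMap_compl_rootsOfUnity` (appended) — the rotation symmetry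
  `F(ζ z) = ζ F(z)`, `ζ ∈ μ_N` (CDT Lemma 5.1.3 / arXiv Lemma 33, from uniqueness up to rotation);
* ★ `exists_circleAverage_posLog_le_of_isCoveringMap_compl_rootsOfUnity` — **CDT Theorem 6.0.1 verbatim
  for the universal covering**: for every `B > 0` there is `C_B` such that for all `N ≥ 2` with
  `N³ > B` and every holomorphic covering `F : 𝔻 → ℂ ∖ μ_N` with `F(0) = 0`,
  `∫_{|z| = 1 − B/N³} log⁺|F| μ_Haar ≤ C_B (log N)/N` (from the previous file's theorem for arbitrary
  disc maps omitting `μ_N`).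

## References
* [CalegariDimitrovTang2025] F. Calegari, V. Dimitrov, Y. Tang, J. Amer. Math. Soc. 38 (2025), §5
  Definition 5.1.2 / arXiv Def. 32, Lemma 33, Theorem 6.0.1.
* [FisherHubbardWittner1988] Y. Fisher, J. H. Hubbard, B. S. Wittner, Proc. AMS 104 (1988) 413–418.
-/

noncomputable section

open Set Metric Filter Real
open scoped Topology

namespace Literature.Analysis.Complex

open _root_.Complex

/-! ### 1. The domain `ℂ ∖ μ_N` -/

/-- `ℂ ∖ μ_N = {z | zᴺ ≠ 1}` is open. [folklore] -/
private theorem isOpen_compl_rootsOfUnity (N : ℕ) : IsOpen {z : ℂ | z ^ N ≠ 1} :=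
  isOpen_ne_fun (continuous_id.pow N) continuous_const

/-- `ℂ ∖ μ_N` is connected for `N ≥ 1` (complement of a finite set in the plane). [folklore] -/
private theorem isConnected_compl_rootsOfUnity {N : ℕ} (hN : 0 < N) :
    IsConnected {z : ℂ | z ^ N ≠ 1} := by
  have hfin : ({z : ℂ | z ^ N = 1} : Set ℂ).Finite := by
    refine (Polynomial.nthRoots N (1 : ℂ)).toFinset.finite_toSet.subset fun z hz ↦ ?_
    simp only [Finset.mem_coe, Multiset.mem_toFinset]
    exact (Polynomial.mem_nthRoots hN).2 hz
  have hrank : 1 < Module.rank ℝ ℂ := by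
    rw [Complex.rank_real_complex]; exact Nat.one_lt_ofNat
  have h := (hfin.countable.isPathConnected_compl_of_one_lt_rank hrank).isConnected
  have hset : ({z : ℂ | z ^ N = 1} : Set ℂ)ᶜ = {z : ℂ | z ^ N ≠ 1} := by
    ext z; simp
  rwa [hset] at h

/-- Two distinct points outside `ℂ ∖ μ_N` for `N ≥ 2`: `1` and `e^{2πi/N}`. [folklore] -/
private theorem exists_two_notMem_compl_rootsOfUnity {N : ℕ} (hN : 2 ≤ N) :
    ∃ a b : ℂ, a ≠ b ∧ a ∉ {z : ℂ | z ^ N ≠ 1} ∧ b ∉ {z : ℂ | z ^ N ≠ 1} := by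
  have hN0 : N ≠ 0 := by omega
  have hprim := Complex.isPrimitiveRoot_exp N hN0
  refine ⟨1, Complex.exp (2 * π * I / N), ?_, by simp, ?_⟩
  · exact (hprim.ne_one (by omega)).symm
  · simp only [mem_setOf_eq, not_not]
    exact hprim.pow_eq_one

/-- The unit disc lies in `ℂ ∖ μ_N` (`‖zᴺ‖ < 1`). [folklore] -/
private theorem mapsTo_id_ball_compl_rootsOfUnity {N : ℕ} (hN : 0 < N) :
    MapsTo (fun z : ℂ ↦ z) (ball (0 : ℂ) 1) {z : ℂ | z ^ N ≠ 1} := by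
  intro z hz
  have h1 : ‖z ^ N‖ < 1 := by
    rw [norm_pow]
    exact pow_lt_one₀ (norm_nonneg z) (mem_ball_zero_iff.1 hz) hN.ne'
  show z ^ N ≠ 1
  intro h
  rw [h, norm_one] at h1
  exact lt_irrefl _ h1

/-! ### 2. Existence and first properties of the universal covering -/

/-- **Existence of the universal covering `F_N : 𝔻 → ℂ ∖ μ_N`, `F_N(0) = 0`** (`N ≥ 2`): a function
holomorphic on the unit disc, mapping it onto `{z | zᴺ ≠ 1}`, whose restriction is a covering map, and
vanishing at `0` (uniformization of plane domains + re-basing by a disc automorphism).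
[cite: CalegariDimitrovTang2025, §5 Definition 32] -/
theorem exists_isCoveringMap_compl_rootsOfUnity {N : ℕ} (hN : 2 ≤ N) :
    ∃ (F : ℂ → ℂ) (hFU : MapsTo F (ball (0 : ℂ) 1) {z : ℂ | z ^ N ≠ 1}),
      DifferentiableOn ℂ F (ball (0 : ℂ) 1) ∧ SurjOn F (ball (0 : ℂ) 1) {z : ℂ | z ^ N ≠ 1} ∧
        IsCoveringMap hFU.restrict ∧ F 0 = 0 := by
  have hN0 : 0 < N := by omega
  obtain ⟨f, hf, hsurj, hfU, hcov⟩ := Complex.planeDomainDiscCovering_holds {z : ℂ | z ^ N ≠ 1}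
    (isOpen_compl_rootsOfUnity N) (isConnected_compl_rootsOfUnity hN0)
    (exists_two_notMem_compl_rootsOfUnity hN)
  have h0U : (0 : ℂ) ∈ {z : ℂ | z ^ N ≠ 1} := by
    simp [zero_pow hN0.ne']
  obtain ⟨ζ₀, hζ₀, hfζ₀⟩ := hsurj h0U
  obtain ⟨F, hFU, hF, hFsurj, hFcov, hF0⟩ :=
    Complex.exists_isCoveringMap_apply_zero_eq hf hfU hsurj hcov hζ₀
  exact ⟨F, hFU, hF, hFsurj, hFcov, by rw [hF0, hfζ₀]⟩

/-- **`‖F′(0)‖ ≥ 1` and `F′ ≠ 0` for a holomorphic covering `F : 𝔻 → ℂ ∖ μ_N` with `F(0) = 0`**: the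
inclusion of the disc into `ℂ ∖ μ_N` is a competitor in the extremal problem solved by the covering
(`Complex.norm_deriv_le_of_isCoveringMap`), and a covering map is locally injective.
[cite: CalegariDimitrovTang2025, §5 Lemma 33 (proof: "F_N is a covering map, F_N′(0) ≠ 0")] -/
theorem one_le_norm_deriv_zero_of_isCoveringMap_compl_rootsOfUnity {N : ℕ} (hN : 0 < N) {F : ℂ → ℂ}
    (hF : DifferentiableOn ℂ F (ball (0 : ℂ) 1)) (hFU : MapsTo F (ball (0 : ℂ) 1) {z : ℂ | z ^ N ≠ 1})
    (hcov : IsCoveringMap hFU.restrict) (hF0 : F 0 = 0) :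
    1 ≤ ‖deriv F 0‖ ∧ ∀ z ∈ ball (0 : ℂ) 1, deriv F z ≠ 0 := by
  refine ⟨?_, fun z hz ↦ Complex.deriv_ne_zero_of_isCoveringMap_ball hF hFU hcov hz⟩
  have h := Complex.norm_deriv_le_of_isCoveringMap hF hFU hcov (f := fun z : ℂ ↦ z)
    differentiableOn_id (mapsTo_id_ball_compl_rootsOfUnity hN) (by rw [hF0])
  have hid : deriv (fun z : ℂ ↦ z) 0 = 1 := deriv_id 0
  rw [hid, norm_one] at h
  exact h

/-! ### 3. CDT Theorem 6.0.1 for the universal covering -/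

/-- ★ **CDT Theorem 6.0.1 for holomorphic coverings `F : 𝔻 → ℂ ∖ μ_N`, `F(0) = 0`.** For every
`B > 0` there is `C_B` such that for all `N ≥ 2` with `N³ > B` and every holomorphic covering map `F` of
`{z | zᴺ ≠ 1}` by the unit disc with `F 0 = 0`:
`∫_{|z| = 1 − B N⁻³} log⁺|F| μ_Haar ≤ C_B · (log N)/N`.
[cite: CalegariDimitrovTang2025, Theorem 6.0.1] -/
theorem exists_circleAverage_posLog_le_of_isCoveringMap_compl_rootsOfUnity {B : ℝ} (hB : 0 < B) :
    ∃ C : ℝ, ∀ (N : ℕ), 2 ≤ N → B < (N : ℝ) ^ 3 → ∀ (F : ℂ → ℂ)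
      (hFU : MapsTo F (ball (0 : ℂ) 1) {z : ℂ | z ^ N ≠ 1}),
      DifferentiableOn ℂ F (ball (0 : ℂ) 1) → IsCoveringMap hFU.restrict → F 0 = 0 →
      circleAverage (fun z ↦ log⁺ ‖F z‖) 0 (1 - B / (N : ℝ) ^ 3) ≤ C * Real.log N / N := by
  obtain ⟨C, hC⟩ := exists_circleAverage_posLog_le_of_omitting_rootsOfUnity hB
  refine ⟨C, fun N hN hBN F hFU hF hcov hF0 ↦ ?_⟩
  obtain ⟨h1, h2⟩ := one_le_norm_deriv_zero_of_isCoveringMap_compl_rootsOfUnity (by omega) hF hFU hcov hF0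
  exact hC N hN hBN F hF hF0 h1 h2 fun z hz ↦ hFU hz

/-! ### 4. The trivial half of the conformal radius: `‖F_N′(0)‖ ≥ 16^{1/N}` (appended) -/

/-- **`‖F′(0)‖ ≥ 16^{1/N}` for a holomorphic covering `F : 𝔻 → ℂ ∖ μ_N` with `F(0) = 0`** — the
subordination ("trivial") half of CDT's conformal radius computation: the map
`z ↦ 16^{1/N} · (λ(zᴺ)/16)^{1/N}` of the tree (`ModularLambda.exists_root_cuspFunction_modularLambda`,
derivative `16^{1/N}` at `0`, values in `ℂ ∖ μ_N`) competes in the extremal problem solved by the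
covering (`Complex.norm_deriv_le_of_isCoveringMap`). The exact value
`‖F_N′(0)‖ = 16^{1/N}(1 + ζ(3)/(2N³) + …)` (CDT Theorem 5.1.4 / arXiv Thm 34, Kraus–Roth) is NOT proved
here. [cite: CalegariDimitrovTang2025, §4.2 proof of Lemma 23 and Theorem 5.1.4] -/
theorem rpow_le_norm_deriv_zero_of_isCoveringMap_compl_rootsOfUnity {N : ℕ} (hN : 0 < N) {F : ℂ → ℂ}
    (hF : DifferentiableOn ℂ F (ball (0 : ℂ) 1)) (hFU : MapsTo F (ball (0 : ℂ) 1) {z : ℂ | z ^ N ≠ 1})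
    (hcov : IsCoveringMap hFU.restrict) (hF0 : F 0 = 0) :
    (16 : ℝ) ^ ((N : ℝ)⁻¹) ≤ ‖deriv F 0‖ := by
  obtain ⟨Φ, hΦd, hΦ0, hΦ1, -, hne⟩ :=
    Literature.NumberTheory.Automorphic.ModularLambda.exists_root_cuspFunction_modularLambda hN
  have hN0 : (N : ℝ) ≠ 0 := by exact_mod_cast hN.ne'
  set r : ℝ := (16 : ℝ) ^ ((N : ℝ)⁻¹) with hr
  have hrpos : 0 < r := by positivity
  have hrN : r ^ N = 16 := by
    rw [hr, ← Real.rpow_natCast, ← Real.rpow_mul (by norm_num), inv_mul_cancel₀ hN0, Real.rpow_one]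
  have hcN : ((r : ℂ)) ^ N = 16 := by exact_mod_cast hrN
  -- the competitor `H = r · Φ : 𝔻 → ℂ ∖ μ_N`
  have hH : MapsTo (fun z ↦ (r : ℂ) * Φ z) (ball (0 : ℂ) 1) {z : ℂ | z ^ N ≠ 1} := by
    intro z hz
    show ((r : ℂ) * Φ z) ^ N ≠ 1
    intro h
    rw [mul_pow, hcN] at h
    exact hne z hz (by linear_combination (1 / 16 : ℂ) * h)
  have hHd : DifferentiableOn ℂ (fun z ↦ (r : ℂ) * Φ z) (ball (0 : ℂ) 1) := hΦd.const_mul _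
  have h := Complex.norm_deriv_le_of_isCoveringMap hF hFU hcov hHd hH (by simp [hΦ0, hF0])
  have hd : deriv (fun z ↦ (r : ℂ) * Φ z) 0 = r := by
    rw [deriv_const_mul _ (hΦd.differentiableAt (ball_mem_nhds (0 : ℂ) one_pos)), hΦ1, mul_one]
  rw [hd, Complex.norm_real, Real.norm_eq_abs, abs_of_pos hrpos] at h
  exact h

/-! ### 5. Rotation symmetry `F_N(ζ x) = ζ F_N(x)` (CDT Lemma 5.1.3 / arXiv Lemma 33; appended) -/

/-- **`F(ζ z) = ζ F(z)` for every holomorphic covering `F : 𝔻 → ℂ ∖ μ_N` with `F(0) = 0` and every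
`N`-th root of unity `ζ`** (CDT Lemma 5.1.3 / arXiv Lemma 33, in the disc model): `ζ⁻¹ F(ζ ·)` is
another covering with the same base point, hence `F(c ·)` for a rotation `c` (uniqueness of the
universal covering up to rotation, `Complex.exists_rotation_of_isCoveringMap`), and comparing
derivatives at `0` (`F′(0) ≠ 0`) gives `c = 1`. [cite: CalegariDimitrovTang2025, Lemma 5.1.3] -/
theorem apply_mul_eq_mul_apply_of_isCoveringMap_compl_rootsOfUnity {N : ℕ} {F : ℂ → ℂ}
    (hF : DifferentiableOn ℂ F (ball (0 : ℂ) 1)) (hFU : MapsTo F (ball (0 : ℂ) 1) {z : ℂ | z ^ N ≠ 1})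
    (hcov : IsCoveringMap hFU.restrict) (hF0 : F 0 = 0) {ζ : ℂ} (hζ : ζ ^ N = 1) {z : ℂ}
    (hz : z ∈ ball (0 : ℂ) 1) : F (ζ * z) = ζ * F z := by
  -- `N ≥ 1` (for `N = 0` the target `{z | z⁰ ≠ 1}` is empty, but the disc is not)
  rcases Nat.eq_zero_or_pos N with rfl | hN
  · exact absurd (pow_zero (F 0)) (hFU (mem_ball_self one_pos))
  have hζ1 : ‖ζ‖ = 1 := by
    have h := congrArg norm hζ
    rw [norm_pow, norm_one] at h
    exact (pow_eq_one_iff_of_nonneg (norm_nonneg ζ) hN.ne').1 h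
  have hζ0 : ζ ≠ 0 := norm_ne_zero_iff.1 (by rw [hζ1]; exact one_ne_zero)
  have hζi1 : ‖ζ⁻¹‖ = 1 := by rw [norm_inv, hζ1, inv_one]
  have hζiN : ζ⁻¹ ^ N = 1 := by rw [inv_pow, hζ, inv_one]
  -- rotations of the disc and of `ℂ ∖ μ_N`
  have hrot : ∀ {d : ℂ}, ‖d‖ = 1 → MapsTo (fun w : ℂ ↦ d * w) (ball (0 : ℂ) 1) (ball 0 1) :=
    fun hd w hw ↦ by
      rw [mem_ball_zero_iff] at hw ⊢
      rwa [norm_mul, hd, one_mul]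
  have hmulU : ∀ {d : ℂ}, d ^ N = 1 →
      MapsTo (fun w : ℂ ↦ d * w) {z : ℂ | z ^ N ≠ 1} {z : ℂ | z ^ N ≠ 1} := fun hd w hw ↦ by
    show (_ * w) ^ N ≠ 1
    rw [mul_pow, hd, one_mul]
    exact hw
  let ρ : ball (0 : ℂ) 1 ≃ₜ ball (0 : ℂ) 1 :=
    { toFun := (hrot hζ1).restrict _ _ _
      invFun := (hrot hζi1).restrict _ _ _
      left_inv := fun w ↦ Subtype.ext (inv_mul_cancel_left₀ hζ0 (w : ℂ))
      right_inv := fun w ↦ Subtype.ext (mul_inv_cancel_left₀ hζ0 (w : ℂ))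
      continuous_toFun := (continuous_const.mul continuous_id).continuousOn.mapsToRestrict _
      continuous_invFun := (continuous_const.mul continuous_id).continuousOn.mapsToRestrict _ }
  let m : {z : ℂ | z ^ N ≠ 1} ≃ₜ {z : ℂ | z ^ N ≠ 1} :=
    { toFun := (hmulU hζiN).restrict _ _ _
      invFun := (hmulU hζ).restrict _ _ _
      left_inv := fun w ↦ Subtype.ext (mul_inv_cancel_left₀ hζ0 (w : ℂ))
      right_inv := fun w ↦ Subtype.ext (inv_mul_cancel_left₀ hζ0 (w : ℂ))
      continuous_toFun := (continuous_const.mul continuous_id).continuousOn.mapsToRestrict _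
      continuous_invFun := (continuous_const.mul continuous_id).continuousOn.mapsToRestrict _ }
  -- the conjugated covering `G = ζ⁻¹ F(ζ ·)`
  set G : ℂ → ℂ := fun w ↦ ζ⁻¹ * F (ζ * w) with hG
  have hGU : MapsTo G (ball (0 : ℂ) 1) {z : ℂ | z ^ N ≠ 1} := fun w hw ↦
    hmulU hζiN (hFU (hrot hζ1 hw))
  have hGd : DifferentiableOn ℂ G (ball (0 : ℂ) 1) :=
    ((hF.comp ((differentiableOn_const ζ).mul differentiableOn_id) (hrot hζ1)).const_mul ζ⁻¹)
  have hGcov : IsCoveringMap hGU.restrict := by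
    have : hGU.restrict = m ∘ (hFU.restrict ∘ ρ) := by
      funext w
      rfl
    rw [this]
    exact (hcov.comp_homeomorph ρ).homeomorph_comp m
  have hG0 : F 0 = G 0 := by simp [hG, hF0]
  obtain ⟨c, hc, hGc⟩ := Complex.exists_rotation_of_isCoveringMap hF hFU hcov hGd hGU hGcov hG0
  -- compare derivatives at `0`
  have hb : ball (0 : ℂ) 1 ∈ 𝓝 (0 : ℂ) := isOpen_ball.mem_nhds (mem_ball_self one_pos)
  have hFat : DifferentiableAt ℂ F 0 := hF.differentiableAt hb
  have hderiv_mul : ∀ d : ℂ, deriv (fun w ↦ F (d * w)) 0 = deriv F 0 * d := by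
    intro d
    have h1 : HasDerivAt (fun w : ℂ ↦ d * w) (d * 1) 0 := (hasDerivAt_id (0 : ℂ)).const_mul d
    have h2 : HasDerivAt F (deriv F (d * 0)) (d * 0) := by rw [mul_zero]; exact hFat.hasDerivAt
    have h3 := h2.comp 0 h1
    rw [mul_zero, mul_one] at h3
    exact h3.deriv
  have hFζat : DifferentiableAt ℂ (fun w ↦ F (ζ * w)) 0 := by
    have h1 : HasDerivAt (fun w : ℂ ↦ ζ * w) (ζ * 1) 0 := (hasDerivAt_id (0 : ℂ)).const_mul ζ
    have h2 : HasDerivAt F (deriv F (ζ * 0)) (ζ * 0) := by rw [mul_zero]; exact hFat.hasDerivAt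
    exact (h2.comp 0 h1).differentiableAt
  have hGderiv : deriv G 0 = deriv F 0 := by
    have h1 : deriv G 0 = ζ⁻¹ * deriv (fun w ↦ F (ζ * w)) 0 := by
      rw [hG]
      exact deriv_const_mul ζ⁻¹ hFζat
    rw [h1, hderiv_mul ζ, mul_comm, mul_assoc, mul_inv_cancel₀ hζ0, mul_one]
  have hGev : G =ᶠ[𝓝 0] fun w ↦ F (c * w) := by
    filter_upwards [hb] with w hw using hGc w hw
  have hc1 : c = 1 := by
    have h := hGev.deriv_eq
    rw [hGderiv, hderiv_mul c] at h
    have hF'0 : deriv F 0 ≠ 0 := Complex.deriv_ne_zero_of_isCoveringMap_ball hF hFU hcov (mem_ball_self one_pos)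
    have : deriv F 0 * (c - 1) = 0 := by rw [mul_sub, mul_one, ← h, sub_self]
    rcases mul_eq_zero.1 this with h0 | h0
    · exact absurd h0 hF'0
    · exact (sub_eq_zero.1 h0)
  -- conclude
  have hGz := hGc z hz
  rw [hc1, one_mul] at hGz
  -- `hGz : ζ⁻¹ * F (ζ * z) = F z`
  have := congrArg (fun w ↦ ζ * w) hGz
  simpa [hG, ← mul_assoc, mul_inv_cancel₀ hζ0] using this

end Literature.Analysis.Complex

end
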